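import Literature.Computability.AlgebraicComplexity.NilCoxeterTensor
import HarnessLib

/-!
# Filtered transfer: `bR(T_{NC_n}) ≤ R(t)` for every length-filtered multiplication table `t` with `gr t = T_{NC_n}`

Topic `Literature/Computability/AlgebraicComplexity`; companion of `NilCoxeterTensor.lean`, whose
`IsApproxDecomposition.nilCoxeterTensor_of_groupTensor` (the Rees twist of an exact decomposition of the
group tensor `T_{K[S_n]}` is an order-`h` approximate decomposition of `T_{NC_n}`, `h = n(n-1)/2`) is the
special case `t = T_{K[S_n]}` of the statement proved here.

The point (Bläser–Lysikov 2016, §2.3 and Lemma 4: a one-parameter family of basis changes `T_w ↦ ε^{ℓ(w)} T_w`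
exhibits the associated graded algebra of a filtered algebra as an algebraic degeneration, hence a tensor
degeneration, hence `bR(gr A) ≤ R(A)`): the twist only uses two properties of the multiplication table
`t(z; x, y)` on `S_n × S_n × S_n` —

* (F) *length filtration*: `t(z; x, y) = 0` unless `inv z ≤ inv x + inv y`;
* (G) *graded part*: `t(z; x, y) = T_{NC_n}(z; x, y)` whenever `inv z = inv x + inv y`

— and every such `t` gives `R_h(T_{NC_n}) ≤ R(t)` and `bR(T_{NC_n}) ≤ R(t)`. Besides `K[S_n]` (where (F) is
the subadditivity `inv(xy) ≤ inv x + inv y` and (G) is the definition of `T_{NC_n}`), the hypotheses hold for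
the whole generic Hecke family `𝓔(a, b)` of `(S_n, {sᵢ})` in the basis `(T_w)` (Humphreys 1990, §7.1), in
particular for the **0-Hecke algebra `H_n(0)`** = the monoid algebra of the 0-Hecke monoid `(S_n, ∘)`
(Demazure product: `ℓ(x ∘ y) ≤ ℓ(x) + ℓ(y)` with equality iff `xy` is reduced, and then `x ∘ y = xy`), whose
rank can be smaller than `R(T_{K[S_n]})` (`n = 3`: `R(T_{H_3(0)}) = 8 < 9 = R(T_{K[S_3]})`, see
`Summits/…/Theorems/NilCoxeterShadowAThesisBorderRankThree.lean`).

## Contents (all proved; no definitions, no named facts)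

* `IsApproxDecomposition.nilCoxeterTensor_of_lengthFiltered` — the Rees twist of an exact decomposition of a
  table `t` with (F), (G) is an order-`h` approximate decomposition of `T_{NC_n}`, `h = n(n-1)/2`.
* `approxRank_nilCoxeterTensor_le_tensorRank_of_lengthFiltered`,
  `algBorderRank_nilCoxeterTensor_le_tensorRank_of_lengthFiltered` — `R_h(T_{NC_n}) ≤ R(t)`, `bR(T_{NC_n}) ≤ R(t)`.
* `groupTensor_lengthFiltered`, `groupTensor_graded` — `T_{K[S_n]}` satisfies (F) and (G) (so
  `algBorderRank_nilCoxeterTensor_le` of `NilCoxeterTensor.lean` is the special case `t = groupTensor`).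
* `IsApproxDecomposition.nilCoxeterTensor_of_lengthFiltered_approx`,
  `approxRank_nilCoxeterTensor_le_approxRank_of_lengthFiltered`,
  `algBorderRank_nilCoxeterTensor_le_algBorderRank_of_lengthFiltered` — the border-to-border version
  `bR(T_{NC_n}) ≤ bR(t)` (substitute `ε ↦ ε^{h+1}` before twisting: degenerations compose).

## References

* [BlaserLysikov2016] M. Bläser, V. Lysikov, *On degeneration of tensors and algebras*, MFCS 2016,
  arXiv:1606.04253, §2.2–2.3, Lemma 4.
* [Blaser2013] M. Bläser, *Fast Matrix Multiplication*, Theory of Computing Graduate Surveys 5 (2013), Def. 6.1.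
* [Humphreys1990] J. E. Humphreys, *Reflection Groups and Coxeter Groups*, CUP 1990, §7.1 (generic algebras).
-/

noncomputable section

open scoped BigOperators Polynomial

namespace Literature.Computability.AlgebraicComplexity

universe u

variable {K : Type u} [CommRing K]

/-- **Rees twist for a length-filtered table.** Let `t : S_n³ → K` satisfy (F) `t(z;x,y) = 0` unless
`inv z ≤ inv x + inv y` and (G) `t(z;x,y) = T_{NC_n}(z;x,y)` when `inv z = inv x + inv y`. If
`t = ∑_ρ w_ρ ⊗ u_ρ ⊗ v_ρ` exactly, then `W_ρ(z) = w_ρ(z) ε^{h - inv z}`, `U_ρ(x) = u_ρ(x) ε^{inv x}`,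
`V_ρ(y) = v_ρ(y) ε^{inv y}` (`h = n(n-1)/2`) form an order-`h` approximate decomposition of `T_{NC_n}`:
entrywise `∑_ρ W U V = t(z;x,y) · ε^{h - inv z + inv x + inv y}`, which is `0` or of degree `> h` off the graded
part and `ε^h T_{NC_n}(z;x,y)` on it. [cite: BlaserLysikov2016, §2.3, Lemma 4] [cite: Blaser2013, Def. 6.1] -/
theorem IsApproxDecomposition.nilCoxeterTensor_of_lengthFiltered {n r : ℕ}
    {t : Equiv.Perm (Fin n) → Equiv.Perm (Fin n) → Equiv.Perm (Fin n) → K}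
    (hF : ∀ z x y, inversionNumber x + inversionNumber y < inversionNumber z → t z x y = 0)
    (hG : ∀ z x y, inversionNumber z = inversionNumber x + inversionNumber y →
      t z x y = nilCoxeterTensor K n z x y)
    {w u v : Fin r → Equiv.Perm (Fin n) → K} (hdec : t = ∑ ρ, triad (w ρ) (u ρ) (v ρ)) :
    IsApproxDecomposition (n * (n - 1) / 2) (nilCoxeterTensor K n)
      (fun ρ z => Polynomial.C (w ρ z) * Polynomial.X ^ (n * (n - 1) / 2 - inversionNumber z))
      (fun ρ x => Polynomial.C (u ρ x) * Polynomial.X ^ inversionNumber x)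
      (fun ρ y => Polynomial.C (v ρ y) * Polynomial.X ^ inversionNumber y) := by
  intro z x y j hj
  set h := n * (n - 1) / 2 with hh
  -- the entry `(z, x, y)` of the exact decomposition
  have hentry : (∑ ρ, w ρ z * u ρ x * v ρ y) = t z x y := by
    have := congrFun (congrFun (congrFun hdec z) x) y
    rw [this, Finset.sum_apply, Finset.sum_apply, Finset.sum_apply]
    simp only [triad_apply]
  -- the twisted sum is a single monomial
  have hmono : (∑ ρ, Polynomial.C (w ρ z) * Polynomial.X ^ (h - inversionNumber z) *
      (Polynomial.C (u ρ x) * Polynomial.X ^ inversionNumber x) *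
      (Polynomial.C (v ρ y) * Polynomial.X ^ inversionNumber y)) =
      Polynomial.C (t z x y) *
        Polynomial.X ^ (h - inversionNumber z + inversionNumber x + inversionNumber y) := by
    rw [← hentry, map_sum, Finset.sum_mul]
    refine Finset.sum_congr rfl fun ρ _ => ?_
    rw [map_mul, map_mul, pow_add, pow_add]
    ring
  rw [hmono, Polynomial.coeff_C_mul_X_pow]
  have hz : inversionNumber z ≤ h := inversionNumber_le z
  by_cases hlen : inversionNumber z = inversionNumber x + inversionNumber y
  · -- graded part: exponent `h`, value `T_{NC_n}(z;x,y)`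
    rw [hG z x y hlen]
    exact if_congr (by omega) rfl rfl
  · have hT : nilCoxeterTensor K n z x y = 0 := by
      rw [nilCoxeterTensor_apply, if_neg (fun h' => hlen h'.2)]
    rw [hT]
    by_cases hlt : inversionNumber x + inversionNumber y < inversionNumber z
    · -- above the filtration: the entry vanishes
      rw [hF z x y hlt]
      split_ifs <;> rfl
    · -- strictly inside the filtration: exponent `> h ≥ j`
      rw [if_neg (by omega)]
      split_ifs <;> rfl

/-- **`R_h(T_{NC_n}) ≤ R(t)`**, `h = n(n-1)/2`, for every length-filtered table `t` with graded part
`T_{NC_n}` (finite format, so `R(t)` is attained). [cite: BlaserLysikov2016, §2.3, Lemma 4] -/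
theorem approxRank_nilCoxeterTensor_le_tensorRank_of_lengthFiltered {n : ℕ}
    {t : Equiv.Perm (Fin n) → Equiv.Perm (Fin n) → Equiv.Perm (Fin n) → K}
    (hF : ∀ z x y, inversionNumber x + inversionNumber y < inversionNumber z → t z x y = 0)
    (hG : ∀ z x y, inversionNumber z = inversionNumber x + inversionNumber y →
      t z x y = nilCoxeterTensor K n z x y) :
    approxRank (n * (n - 1) / 2) (nilCoxeterTensor K n) ≤ tensorRank t := by
  obtain ⟨w, u, v, hdec⟩ := exists_triad_decomposition_tensorRank t
  exact approxRank_le_of_isApproxDecomposition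
    (IsApproxDecomposition.nilCoxeterTensor_of_lengthFiltered hF hG hdec)

/-- **Filtered transfer `bR(T_{NC_n}) ≤ R(t)`**: the border rank over `K[ε]` of the nil-Coxeter tensor is
at most the rank of ANY length-filtered multiplication table on `K^{S_n}` whose graded part is `T_{NC_n}` —
the group algebra `K[S_n]`, the Hecke algebras `H_n(q)`, the 0-Hecke algebra `H_n(0)`, … (the tensor shadow of
"`gr A` is a degeneration of `A`"). [cite: BlaserLysikov2016, §2.3, Lemma 4] [cite: Blaser2013, Def. 6.1] -/
theorem algBorderRank_nilCoxeterTensor_le_tensorRank_of_lengthFiltered {n : ℕ}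
    {t : Equiv.Perm (Fin n) → Equiv.Perm (Fin n) → Equiv.Perm (Fin n) → K}
    (hF : ∀ z x y, inversionNumber x + inversionNumber y < inversionNumber z → t z x y = 0)
    (hG : ∀ z x y, inversionNumber z = inversionNumber x + inversionNumber y →
      t z x y = nilCoxeterTensor K n z x y) :
    algBorderRank (nilCoxeterTensor K n) ≤ tensorRank t :=
  (algBorderRank_le_approxRank _ _).trans (approxRank_nilCoxeterTensor_le_tensorRank_of_lengthFiltered hF hG)

/-- The group tensor `T_{K[S_n]}` is length-filtered (F): `[xy = z] = 0` when `inv x + inv y < inv z`, by the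
subadditivity `inv(xy) ≤ inv x + inv y`. [cite: Humphreys1990, §1.6, Exercise 1(b)] -/
theorem groupTensor_lengthFiltered {n : ℕ} (z x y : Equiv.Perm (Fin n))
    (hlt : inversionNumber x + inversionNumber y < inversionNumber z) :
    groupTensor K (Equiv.Perm (Fin n)) z x y = 0 := by
  rw [groupTensor_apply, if_neg]
  rintro rfl
  exact absurd (inversionNumber_mul_le x y) (by omega)

/-- The group tensor has graded part `T_{NC_n}` (G): on `inv z = inv x + inv y` the two tables agree.
[cite: BlaserLysikov2016, §2.3] -/
theorem groupTensor_graded {n : ℕ} (z x y : Equiv.Perm (Fin n))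
    (hlen : inversionNumber z = inversionNumber x + inversionNumber y) :
    groupTensor K (Equiv.Perm (Fin n)) z x y = nilCoxeterTensor K n z x y := by
  rw [groupTensor_apply, nilCoxeterTensor_apply]
  exact if_congr ⟨fun h => ⟨h, hlen⟩, fun h => h.1⟩ rfl rfl


/-! ## Border-to-border transfer: `bR(T_{NC_n}) ≤ bR(t)` for length-filtered `t`

Degenerations compose: if `t` itself only has an APPROXIMATE decomposition of order `h'`, substitute
`ε ↦ ε^{h+1}` (`Polynomial.expand`, `h = n(n-1)/2`) before applying the Rees twist; then every junk term
of the given decomposition (degrees `> h'`, now `≥ (h+1)(h'+1)`) lies above the target order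
`H = (h+1)h' + h`, whatever power `ε^e`, `0 ≤ e ≤ 3h`, the twist attaches to the entry. -/

/-- **Rees twist of an approximate decomposition of a length-filtered table.** With `t` as in
`IsApproxDecomposition.nilCoxeterTensor_of_lengthFiltered` ((F) and (G)), `h = n(n-1)/2`, `M = h + 1`: if
`∑_ρ u_ρ ⊗ v_ρ ⊗ w_ρ = ε^{h'} t + O(ε^{h'+1})`, then `U_ρ(z) = u_ρ(z)(ε^M) ε^{h - inv z}`,
`V_ρ(x) = v_ρ(x)(ε^M) ε^{inv x}`, `W_ρ(y) = w_ρ(y)(ε^M) ε^{inv y}` satisfy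
`∑_ρ U_ρ ⊗ V_ρ ⊗ W_ρ = ε^{M h' + h} T_{NC_n} + O(ε^{M h' + h + 1})`.
[cite: BlaserLysikov2016, §2.3, Lemma 4] [cite: Blaser2013, Def. 6.1] -/
theorem IsApproxDecomposition.nilCoxeterTensor_of_lengthFiltered_approx {n r h' : ℕ}
    {t : Equiv.Perm (Fin n) → Equiv.Perm (Fin n) → Equiv.Perm (Fin n) → K}
    (hF : ∀ z x y, inversionNumber x + inversionNumber y < inversionNumber z → t z x y = 0)
    (hG : ∀ z x y, inversionNumber z = inversionNumber x + inversionNumber y →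
      t z x y = nilCoxeterTensor K n z x y)
    {u v w : Fin r → Equiv.Perm (Fin n) → K[X]} (hd : IsApproxDecomposition h' t u v w) :
    IsApproxDecomposition ((n * (n - 1) / 2 + 1) * h' + n * (n - 1) / 2) (nilCoxeterTensor K n)
      (fun ρ z => Polynomial.expand K (n * (n - 1) / 2 + 1) (u ρ z) *
        Polynomial.X ^ (n * (n - 1) / 2 - inversionNumber z))
      (fun ρ x => Polynomial.expand K (n * (n - 1) / 2 + 1) (v ρ x) * Polynomial.X ^ inversionNumber x)
      (fun ρ y => Polynomial.expand K (n * (n - 1) / 2 + 1) (w ρ y) * Polynomial.X ^ inversionNumber y) := by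
  intro z x y j hj
  set h := n * (n - 1) / 2 with hh
  set S : K[X] := ∑ ρ, u ρ z * v ρ x * w ρ y with hSdef
  have hS : ∀ i ≤ h', S.coeff i = if i = h' then t z x y else 0 := fun i hi => hd z x y i hi
  have hM : 0 < h + 1 := Nat.succ_pos h
  -- the twisted sum is `expand (h+1) S · X^e`
  have hsum : (∑ ρ, Polynomial.expand K (h + 1) (u ρ z) * Polynomial.X ^ (h - inversionNumber z) *
      (Polynomial.expand K (h + 1) (v ρ x) * Polynomial.X ^ inversionNumber x) *
      (Polynomial.expand K (h + 1) (w ρ y) * Polynomial.X ^ inversionNumber y)) =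
      Polynomial.expand K (h + 1) S *
        Polynomial.X ^ (h - inversionNumber z + inversionNumber x + inversionNumber y) := by
    rw [hSdef, map_sum, Finset.sum_mul]
    refine Finset.sum_congr rfl fun ρ _ => ?_
    rw [map_mul, map_mul, pow_add, pow_add]
    ring
  rw [hsum, Polynomial.coeff_mul_X_pow']
  have hz : inversionNumber z ≤ h := inversionNumber_le z
  by_cases hgr : inversionNumber z = inversionNumber x + inversionNumber y
  · -- graded entry: exponent `h`, value `T_{NC_n}(z;x,y) = t(z;x,y)` sits in degree `(h+1) h' + h`
    rw [← hG z x y hgr]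
    have he : h - inversionNumber z + inversionNumber x + inversionNumber y = h := by omega
    rw [he]
    by_cases hjh : h ≤ j
    · rw [if_pos hjh, Polynomial.coeff_expand hM]
      by_cases hdvd : (h + 1) ∣ (j - h)
      · obtain ⟨i, hi⟩ := hdvd
        rw [if_pos ⟨i, hi⟩, hi, Nat.mul_div_cancel_left i hM]
        have hi' : i ≤ h' := by
          by_contra hlt
          have : (h + 1) * (h' + 1) ≤ (h + 1) * i := Nat.mul_le_mul_left _ (by omega)
          have e1 : j = (h + 1) * i + h := by omega
          rw [e1] at hj
          nlinarith
        rw [hS i hi']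
        by_cases hih : i = h'
        · subst hih
          rw [if_pos rfl, if_pos (by omega)]
        · rw [if_neg hih, if_neg]
          intro hjH
          apply hih
          have e1 : (h + 1) * i = (h + 1) * h' := by omega
          exact Nat.eq_of_mul_eq_mul_left hM e1
      · rw [if_neg hdvd, if_neg]
        intro hjH
        exact hdvd ⟨h', by omega⟩
    · rw [if_neg hjh, if_neg (by omega)]
  · -- off the graded part: the target entry is `0`, and so is every coefficient through the target order
    have hT : nilCoxeterTensor K n z x y = 0 := by
      rw [nilCoxeterTensor_apply, if_neg (fun h' => hgr h'.2)]
    rw [hT, ite_self]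
    split_ifs with hle
    · rw [Polynomial.coeff_expand hM]
      split_ifs with hdvd
      · obtain ⟨i, hi⟩ := hdvd
        rw [hi, Nat.mul_div_cancel_left i hM]
        by_cases hlt : inversionNumber x + inversionNumber y < inversionNumber z
        · -- above the filtration: `t(z;x,y) = 0`, so all known coefficients vanish; unknown ones are too high
          have hi' : i ≤ h' := by
            by_contra hgt
            have : (h + 1) * (h' + 1) ≤ (h + 1) * i := Nat.mul_le_mul_left _ (by omega)
            have e1 : j = (h + 1) * i + (h - inversionNumber z + inversionNumber x + inversionNumber y) := by
              omega
            rw [e1] at hj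
            nlinarith
          rw [hS i hi', hF z x y hlt, ite_self]
        · -- strictly inside the filtration: the attached power exceeds `h`, so `i < h'`
          have hi' : i < h' := by
            by_contra hge
            have : (h + 1) * h' ≤ (h + 1) * i := Nat.mul_le_mul_left _ (by omega)
            have e1 : j = (h + 1) * i + (h - inversionNumber z + inversionNumber x + inversionNumber y) := by
              omega
            rw [e1] at hj
            omega
          rw [hS i hi'.le, if_neg (Nat.ne_of_lt hi')]
      · rfl
    · rfl

/-- **`bR(T_{NC_n}) ≤ R_{h'}(t)`-transfer of orders: `R_{(h+1)h'+h}(T_{NC_n}) ≤ R_{h'}(t)`**, `h = n(n-1)/2`,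
for every length-filtered table `t` with graded part `T_{NC_n}`. [cite: BlaserLysikov2016, §2.3, Lemma 4] -/
theorem approxRank_nilCoxeterTensor_le_approxRank_of_lengthFiltered {n : ℕ} (h' : ℕ)
    {t : Equiv.Perm (Fin n) → Equiv.Perm (Fin n) → Equiv.Perm (Fin n) → K}
    (hF : ∀ z x y, inversionNumber x + inversionNumber y < inversionNumber z → t z x y = 0)
    (hG : ∀ z x y, inversionNumber z = inversionNumber x + inversionNumber y →
      t z x y = nilCoxeterTensor K n z x y) :
    approxRank ((n * (n - 1) / 2 + 1) * h' + n * (n - 1) / 2) (nilCoxeterTensor K n) ≤ approxRank h' t := by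
  obtain ⟨u, v, w, hd⟩ := Nat.sInf_mem (s := {r : ℕ | ∃ (u : Fin r → Equiv.Perm (Fin n) → K[X])
    (v : Fin r → Equiv.Perm (Fin n) → K[X]) (w : Fin r → Equiv.Perm (Fin n) → K[X]),
    IsApproxDecomposition h' t u v w}) (exists_isApproxDecomposition h' t)
  exact approxRank_le_of_isApproxDecomposition
    (IsApproxDecomposition.nilCoxeterTensor_of_lengthFiltered_approx hF hG hd)

/-- **Border-to-border filtered transfer `bR(T_{NC_n}) ≤ bR(t)`**: the border rank of the nil-Coxeter tensor
is at most the BORDER rank of any length-filtered table with graded part `T_{NC_n}` (degenerations compose;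
e.g. `t = T_{H_n(0)}`, itself a degeneration of `T_{K[S_n]}`). [cite: BlaserLysikov2016, §2.3, Lemma 4]
[cite: Blaser2013, Def. 6.1] -/
theorem algBorderRank_nilCoxeterTensor_le_algBorderRank_of_lengthFiltered {n : ℕ}
    {t : Equiv.Perm (Fin n) → Equiv.Perm (Fin n) → Equiv.Perm (Fin n) → K}
    (hF : ∀ z x y, inversionNumber x + inversionNumber y < inversionNumber z → t z x y = 0)
    (hG : ∀ z x y, inversionNumber z = inversionNumber x + inversionNumber y →
      t z x y = nilCoxeterTensor K n z x y) :
    algBorderRank (nilCoxeterTensor K n) ≤ algBorderRank t := by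
  obtain ⟨h', hh'⟩ := Nat.sInf_mem (Set.range_nonempty fun h' : ℕ => approxRank h' t)
  have hbt : algBorderRank t = approxRank h' t := hh'.symm
  rw [hbt]
  exact (algBorderRank_le_approxRank _ _).trans
    (approxRank_nilCoxeterTensor_le_approxRank_of_lengthFiltered h' hF hG)

end Literature.Computability.AlgebraicComplexity

end
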